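import Literature.Topology.FourManifolds.KnotArcLift
import Mathlib.Topology.Homotopy.Lifting
import Mathlib.Topology.Covering.AddCircle
import Mathlib.Analysis.Convex.Contractible
import Mathlib.Topology.Algebra.Module.LocallyConvex
import HarnessLib

/-!
# Lifts and winding increments of circle-valued maps through `circlePt`

Helper layer `helper_degree_lift` of the brick `helper_sliceGluing_vanishingDegree` (apex leaf
F0, the degree lemma) of line `Sketch`, crux `SblfDescent.RungOne`
(crux item stmt-SmoothPoincare4-18531).

The degree lemma is stated with the unit-period parametrisation
`circlePt : ℝ → 𝕊¹ ⊆ ℝ²`, `t ↦ (cos 2πt, sin 2πt)` (`TorusCoordinates.lean`): a loop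
`a : ℝ → 𝕊¹` with `a (t + 1) = a t` has *degree zero* iff it has a continuous `1`-periodic lift
`L` with `a = circlePt ∘ L`.  This file provides the covering-space toolkit behind that phrasing,
transported from Mathlib's covering `ℝ → ℝ/2πℤ` (`AddCircle.isCoveringMap_coe`) along
`AddCircle.homeomorphCircle'` and the injection `toCircle : 𝕊¹ → Circle` (the fibres of
`circlePt` are the cosets of `ℤ`: `circlePt_eq_circlePt_iff`, `KnotFraming.lean`):

* `helper_degree_exists_lift` — every continuous map from a simply connected, locally path
  connected space to `𝕊¹` factors continuously through `circlePt` (Hatcher, Prop. 1.33);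
* `helper_degree_lift_unique` — two continuous lifts on a preconnected space differ by a
  constant integer (Hatcher, Prop. 1.34);
* `helper_degree_exists_increment` — a continuous lift `L` of a `1`-periodic loop satisfies
  `L (t + 1) = L t + k` for one integer `k` (its winding number, Hatcher Thm. 1.7);
* `helper_degree_homotopy` — the increment is constant in a continuous one-parameter family of
  `1`-periodic loops (homotopy invariance of the degree).

## References

* A. Hatcher, *Algebraic Topology* (2002), Thm. 1.7, Prop. 1.30, Prop. 1.33, Prop. 1.34.
  [HatcherAT2002]
-/

set_option linter.dupNamespace false

noncomputable section

open scoped Manifold ContDiff Topology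
open Set Function Literature.Topology.FourManifolds

namespace Summit.SmoothPoincare4.SmoothPoincare4.Cruxes.RungOne.Sketch

/-- **Lifting through `circlePt`** (Hatcher, Prop. 1.33 for the covering `ℝ → (Metric.sphere (0 : EuclideanSpace ℝ (Fin 2)) 1)`): a continuous
map from a simply connected, locally path connected space to the circle `(Metric.sphere (0 : EuclideanSpace ℝ (Fin 2)) 1) ⊆ ℝ²` factors
continuously through `circlePt`. [cite: HatcherAT2002, Prop. 1.33] -/
theorem helper_degree_exists_lift {A : Type*} [TopologicalSpace A] [SimplyConnectedSpace A]
    [LocallyPathConnectedSpace A] {φ : A → (Metric.sphere (0 : EuclideanSpace ℝ (Fin 2)) 1)} (hφ : Continuous φ) :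
    ∃ L : A → ℝ, Continuous L ∧ ∀ a, φ a = circlePt (L a) := by
  obtain ⟨a₀⟩ := (inferInstance : Nonempty A)
  -- transport to the additive circle `ℝ / 2πℤ`
  set e := AddCircle.homeomorphCircle' with he
  set ψ : C(A, AddCircle (2 * Real.pi)) :=
    ⟨fun a => e.symm (toCircle (φ a)),
      e.symm.continuous.comp (continuous_toCircle.comp hφ)⟩ with hψ
  obtain ⟨x₀, hx₀⟩ := QuotientAddGroup.mk_surjective (ψ a₀)
  obtain ⟨F, ⟨hF0, hF⟩, -⟩ :=
    (AddCircle.isCoveringMap_coe (2 * Real.pi)).existsUnique_continuousMap_lifts ψ a₀ x₀ hx₀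
  refine ⟨fun a => F a / (2 * Real.pi), F.continuous.div_const _, fun a => ?_⟩
  apply toCircle_injective
  have h1 : ((F a : ℝ) : AddCircle (2 * Real.pi)) = ψ a := congrFun hF a
  have h2 : toCircle (φ a) = e (ψ a) := by
    simp [hψ]
  rw [h2, ← h1, toCircle_circlePt, he, AddCircle.homeomorphCircle'_apply_mk]
  congr 1
  field_simp

/-- **Uniqueness of lifts up to an integer** (Hatcher, Prop. 1.34): two continuous lifts through
`circlePt` of the same map on a preconnected space differ by a constant integer.
[cite: HatcherAT2002, Prop. 1.34] -/
theorem helper_degree_lift_unique {A : Type*} [TopologicalSpace A] [PreconnectedSpace A]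
    {L M : A → ℝ} (hL : Continuous L) (hM : Continuous M)
    (h : ∀ a, circlePt (L a) = circlePt (M a)) : ∃ k : ℤ, ∀ a, L a = M a + k := by
  have hint : ∀ a, ∃ k : ℤ, L a - M a = k := fun a => by
    obtain ⟨k, hk⟩ := circlePt_eq_circlePt_iff.1 (h a)
    exact ⟨k, by linarith⟩
  rcases isEmpty_or_nonempty A with hA | ⟨⟨a₀⟩⟩
  · exact ⟨0, fun a => (IsEmpty.false a).elim⟩
  obtain ⟨k₀, hk₀⟩ := hint a₀
  refine ⟨k₀, fun a => ?_⟩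
  obtain ⟨k, hk⟩ := hint a
  suffices hkk : k = k₀ by rw [hkk] at hk; linarith
  by_contra hne
  have hD : Continuous fun x => L x - M x := hL.sub hM
  -- the difference takes every value between `k` and `k₀`, in particular a non-integer
  rcases lt_or_gt_of_ne hne with hlt | hlt
  · have hmem : ((k : ℝ) + 1 / 2) ∈ Icc (L a - M a) (L a₀ - M a₀) := by
      rw [hk, hk₀]
      have : (k : ℝ) + 1 ≤ k₀ := by exact_mod_cast hlt
      constructor <;> linarith
    obtain ⟨c, hc⟩ := intermediate_value_univ a a₀ hD hmem
    obtain ⟨m, hm⟩ := hint c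
    have h1 : (m : ℝ) = k + 1 / 2 := by rw [← hm]; exact hc
    have h2 : (2 * m : ℤ) = 2 * k + 1 := by exact_mod_cast (by linarith : (2 * m : ℝ) = 2 * k + 1)
    omega
  · have hmem : ((k₀ : ℝ) + 1 / 2) ∈ Icc (L a₀ - M a₀) (L a - M a) := by
      rw [hk, hk₀]
      have : (k₀ : ℝ) + 1 ≤ k := by exact_mod_cast hlt
      constructor <;> linarith
    obtain ⟨c, hc⟩ := intermediate_value_univ a₀ a hD hmem
    obtain ⟨m, hm⟩ := hint c
    have h1 : (m : ℝ) = k₀ + 1 / 2 := by rw [← hm]; exact hc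
    have h2 : (2 * m : ℤ) = 2 * k₀ + 1 := by exact_mod_cast (by linarith : (2 * m : ℝ) = 2 * k₀ + 1)
    omega

/-- **The winding increment of a periodic loop** (Hatcher, Thm. 1.7): a continuous lift `L`
through `circlePt` of a `1`-periodic loop satisfies `L (t + 1) = L t + k` for a single integer `k`
(the degree of the loop). [cite: HatcherAT2002, Thm. 1.7] -/
theorem helper_degree_exists_increment {φ : ℝ → (Metric.sphere (0 : EuclideanSpace ℝ (Fin 2)) 1)} (hper : ∀ t, φ (t + 1) = φ t)
    {L : ℝ → ℝ} (hL : Continuous L) (hlift : ∀ t, φ t = circlePt (L t)) :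
    ∃ k : ℤ, ∀ t, L (t + 1) = L t + k := by
  have hM : Continuous fun t => L (t + 1) := hL.comp (continuous_id.add continuous_const)
  refine helper_degree_lift_unique hM hL fun t => ?_
  rw [← hlift, ← hlift, hper]

/-- **The increment does not depend on the lift**: two continuous lifts of the same `1`-periodic
loop have the same increment. [cite: HatcherAT2002, Thm. 1.7] -/
theorem helper_degree_increment_unique {L M : ℝ → ℝ} (hL : Continuous L) (hM : Continuous M)
    (h : ∀ t, circlePt (L t) = circlePt (M t)) {k k' : ℤ}
    (hk : ∀ t, L (t + 1) = L t + k) (hk' : ∀ t, M (t + 1) = M t + k') : k = k' := by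
  obtain ⟨m, hm⟩ := helper_degree_lift_unique hL hM h
  have e1 := hk 0
  have e2 := hk' 0
  rw [hm, hm] at e1
  exact_mod_cast (by linarith : (k : ℝ) = k')

/-- **Homotopy invariance of the degree**: in a continuous family `Φ s` of `1`-periodic loops in
`(Metric.sphere (0 : EuclideanSpace ℝ (Fin 2)) 1)` parametrised by `s ∈ ℝ`, every continuous lift of every member has the same increment.
(Lift the whole family over the simply connected `ℝ × ℝ`; Hatcher, Thm. 1.7 and Prop. 1.30.)
[cite: HatcherAT2002, Thm. 1.7, Prop. 1.30] -/
theorem helper_degree_homotopy' {Φ : ℝ → ℝ → (Metric.sphere (0 : EuclideanSpace ℝ (Fin 2)) 1)} (hΦ : Continuous (uncurry Φ))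
    (hper : ∀ s t, Φ s (t + 1) = Φ s t) :
    ∃ k : ℤ, ∀ (s : ℝ) (L : ℝ → ℝ), Continuous L → (∀ t, Φ s t = circlePt (L t)) →
      ∀ t, L (t + 1) = L t + k := by
  obtain ⟨L₂, hL₂, hlift⟩ := helper_degree_exists_lift (A := ℝ × ℝ) hΦ
  have hsh : Continuous fun p : ℝ × ℝ => L₂ (p.1, p.2 + 1) :=
    hL₂.comp (continuous_fst.prodMk (continuous_snd.add continuous_const))
  obtain ⟨k, hk⟩ := helper_degree_lift_unique (A := ℝ × ℝ) hsh hL₂ fun p => by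
    rw [← hlift, ← hlift]; exact hper p.1 p.2
  refine ⟨k, fun s L hL hL' t => ?_⟩
  have hLs : Continuous fun t => L₂ (s, t) := hL₂.comp (continuous_const.prodMk continuous_id)
  obtain ⟨m, hm⟩ := helper_degree_lift_unique hL hLs fun t => by rw [← hL', ← hlift]; rfl
  rw [hm, hm]
  have := hk (s, t)
  simp only at this
  linarith

/-- **Homotopy invariance of the degree** (registered form of `helper_degree_homotopy'`, layer A
of the degree lemma `helper_sliceGluing_vanishingDegree`): in a continuous family of `1`-periodic
loops in `𝕊¹` parametrised by `ℝ`, all continuous lifts of all members have one and the same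
increment. [cite: HatcherAT2002, Thm. 1.7, Prop. 1.30] -/
theorem helper_degree_homotopy : ∀ (Φ : ℝ → ℝ → Metric.sphere (0 : EuclideanSpace ℝ (Fin 2)) 1), Continuous (Function.uncurry Φ) → (∀ s t, Φ s (t + 1) = Φ s t) → ∃ k : ℤ, ∀ (s : ℝ) (L : ℝ → ℝ), Continuous L → (∀ t, Φ s t = circlePt (L t)) → ∀ t, L (t + 1) = L t + k := by
  intro Φ hΦ hper
  exact helper_degree_homotopy' hΦ hper

/-- **Degree zero means a periodic lift**: if one continuous lift of a `1`-periodic loop has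
increment `0`, the loop has a continuous `1`-periodic lift (namely that one); conversely a
`1`-periodic continuous lift forces every continuous lift to have increment `0`.
[cite: HatcherAT2002, Thm. 1.7] -/
theorem helper_degree_periodic_lift_iff {φ : ℝ → (Metric.sphere (0 : EuclideanSpace ℝ (Fin 2)) 1)}
    {L : ℝ → ℝ} (hL : Continuous L) (hlift : ∀ t, φ t = circlePt (L t)) {k : ℤ}
    (hk : ∀ t, L (t + 1) = L t + k) :
    (∃ M : ℝ → ℝ, Continuous M ∧ (∀ t, M (t + 1) = M t) ∧ ∀ t, φ t = circlePt (M t)) ↔ k = 0 := by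
  constructor
  · rintro ⟨M, hM, hMper, hMlift⟩
    have := helper_degree_increment_unique hL hM (fun t => by rw [← hlift, ← hMlift]) hk
      (k' := 0) (fun t => by rw [hMper]; simp)
    exact this
  · rintro rfl
    exact ⟨L, hL, fun t => by simpa using hk t, hlift⟩

/-- **`circlePt` maps every half-open interval of length one onto the circle.**
[cite: HatcherAT2002, Thm. 1.7] -/
theorem helper_degree_circlePt_surjOn (y : ℝ) (p : (Metric.sphere (0 : EuclideanSpace ℝ (Fin 2)) 1)) : ∃ s ∈ Ico y (y + 1), circlePt s = p := by
  obtain ⟨θ, rfl⟩ := circlePoint_surjective p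
  set s₀ : ℝ := θ / (2 * Real.pi) with hs₀
  have hθ : circlePoint θ = circlePt s₀ := by
    rw [circlePt_eq_circlePoint]; congr 1; rw [hs₀]; field_simp
  refine ⟨s₀ - ⌊s₀ - y⌋, ⟨?_, ?_⟩, ?_⟩
  · have := Int.floor_le (s₀ - y); linarith
  · have := Int.lt_floor_add_one (s₀ - y); linarith
  · rw [hθ, sub_eq_add_neg, ← Int.cast_neg]
    exact circlePt_add_int _ _

/-- **A continuous injective self-map of the circle is onto** (its degree is not zero: a lift
with increment `0` would take some value twice on `[0, 1)`, contradicting injectivity, and a lift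
with increment `k ≠ 0` covers an interval of length `≥ 1`). [cite: HatcherAT2002, Thm. 1.7] -/
theorem helper_degree_surjective_of_injective {j : (Metric.sphere (0 : EuclideanSpace ℝ (Fin 2)) 1) → (Metric.sphere (0 : EuclideanSpace ℝ (Fin 2)) 1)} (hj : Continuous j)
    (hinj : Injective j) : Surjective j := by
  have hφ : Continuous fun t => j (circlePt t) := hj.comp continuous_circlePt
  obtain ⟨L, hL, hlift⟩ := helper_degree_exists_lift (A := ℝ) hφ
  obtain ⟨k, hk⟩ := helper_degree_exists_increment (φ := fun t => j (circlePt t))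
    (fun t => by simp [circlePt_add_one]) hL hlift
  -- two parameters in `[0, 1)` with the same lift value coincide
  have key : ∀ t₁ t₂, 0 ≤ t₁ → t₁ < t₂ → t₂ < 1 → L t₁ ≠ L t₂ := by
    intro t₁ t₂ h1 h12 h2 heq
    have e : j (circlePt t₁) = j (circlePt t₂) := by rw [hlift, hlift, heq]
    obtain ⟨m, hm⟩ := circlePt_eq_circlePt_iff.1 (hinj e)
    have hm0 : (m : ℝ) < 0 := by linarith
    have hm1 : (-1 : ℝ) < m := by linarith
    have : m < 0 := by exact_mod_cast hm0
    have : -1 < m := by exact_mod_cast hm1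
    omega
  have hk0 : k ≠ 0 := by
    rintro rfl
    have h01 : L 1 = L 0 := by simpa using hk 0
    -- `L` is not constant on `[0, 1)` (else `j ∘ circlePt` would be constant there)
    have h12 : L 0 ≠ L (1 / 2) := key 0 (1 / 2) le_rfl (by norm_num) (by norm_num)
    rcases lt_or_gt_of_ne h12 with hlt | hlt
    · -- the value `(L 0 + L (1/2)) / 2` is taken on `[0, 1/2]` and on `[1/2, 1]`
      have hmem₁ : (L 0 + L (1 / 2)) / 2 ∈ Icc (L 0) (L (1 / 2)) := by
        constructor <;> linarith
      have hmem₂ : (L 0 + L (1 / 2)) / 2 ∈ Icc (L 1) (L (1 / 2)) := by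
        rw [h01]; constructor <;> linarith
      obtain ⟨c₁, hc₁, hc₁v⟩ :=
        intermediate_value_Icc (show (0 : ℝ) ≤ 1 / 2 by norm_num) hL.continuousOn hmem₁
      obtain ⟨c₂, hc₂, hc₂v⟩ :=
        intermediate_value_Icc' (show (1 / 2 : ℝ) ≤ 1 by norm_num) hL.continuousOn hmem₂
      have hc₁lt : c₁ < 1 / 2 := by
        rcases hc₁.2.lt_or_eq with h | h
        · exact h
        · exfalso; rw [h] at hc₁v; linarith
      have hc₂lt : c₂ < 1 := by
        rcases hc₂.2.lt_or_eq with h | h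
        · exact h
        · exfalso; rw [h, h01] at hc₂v; linarith
      exact key c₁ c₂ hc₁.1 (by linarith [hc₂.1]) hc₂lt (by rw [hc₁v, hc₂v])
    · have hmem₁ : (L 0 + L (1 / 2)) / 2 ∈ Icc (L (1 / 2)) (L 0) := by
        constructor <;> linarith
      have hmem₂ : (L 0 + L (1 / 2)) / 2 ∈ Icc (L (1 / 2)) (L 1) := by
        rw [h01]; constructor <;> linarith
      obtain ⟨c₁, hc₁, hc₁v⟩ :=
        intermediate_value_Icc' (show (0 : ℝ) ≤ 1 / 2 by norm_num) hL.continuousOn hmem₁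
      obtain ⟨c₂, hc₂, hc₂v⟩ :=
        intermediate_value_Icc (show (1 / 2 : ℝ) ≤ 1 by norm_num) hL.continuousOn hmem₂
      have hc₁lt : c₁ < 1 / 2 := by
        rcases hc₁.2.lt_or_eq with h | h
        · exact h
        · exfalso; rw [h] at hc₁v; linarith
      have hc₂lt : c₂ < 1 := by
        rcases hc₂.2.lt_or_eq with h | h
        · exact h
        · exfalso; rw [h, h01] at hc₂v; linarith
      exact key c₁ c₂ hc₁.1 (by linarith [hc₂.1]) hc₂lt (by rw [hc₁v, hc₂v])
  -- increment `k ≠ 0`: the lift covers `[L 0, L 0 + k]` or `[L 0 + k, L 0]`, of length `≥ 1`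
  intro p
  rcases lt_or_gt_of_ne hk0 with hneg | hpos
  · have hk1 : (k : ℝ) ≤ -1 := by exact_mod_cast (show k ≤ -1 by omega)
    obtain ⟨s, hs, hsp⟩ := helper_degree_circlePt_surjOn (L 0 + k) p
    have hmem : s ∈ Icc (L 1) (L 0) := by
      rw [show L 1 = L 0 + k by simpa using hk 0]
      exact ⟨hs.1, by linarith [hs.2]⟩
    obtain ⟨c, -, hc⟩ := intermediate_value_Icc' zero_le_one hL.continuousOn hmem
    exact ⟨circlePt c, by rw [hlift, hc, hsp]⟩
  · have hk1 : (1 : ℝ) ≤ k := by exact_mod_cast (show 1 ≤ k by omega)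
    obtain ⟨s, hs, hsp⟩ := helper_degree_circlePt_surjOn (L 0) p
    have hmem : s ∈ Icc (L 0) (L 1) := by
      rw [show L 1 = L 0 + k by simpa using hk 0]
      exact ⟨hs.1, by linarith [hs.2]⟩
    obtain ⟨c, -, hc⟩ := intermediate_value_Icc zero_le_one hL.continuousOn hmem
    exact ⟨circlePt c, by rw [hlift, hc, hsp]⟩

end Summit.SmoothPoincare4.SmoothPoincare4.Cruxes.RungOne.Sketch

end
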